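import Summits.HodgeConjecture.HodgeConjecture.Theorems.K2LiuSiegelBruhatCellsDelta     -- ★ p02: frame transport, `frame_blk_unitary`, B1 `unip_unitary_iff`
import Summits.HodgeConjecture.HodgeConjecture.Theorems.K2LiuWeylDeltaRational           -- ★ p06 (+ ★ `mem_range_toAdelic_iff`)
import HarnessLib

/-!
# The coordinate chart `X ↦ n(X)` of the unipotent radical `N_Δ(𝔸)` of the doubled Siegel parabolic (organ E5′c ∕ (C0), file 1)

Track B ∕ hLiu418 = stmt-HodgeConjecture-24832, line `K2_Liu_CurveThetaSigs`, socket #41, organ O41.3 (seat `hodgecm-mathlib-K2Liu-p06` (g0),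
LEAD F0P6-plan deal 2026-09-03T23:05:23Z); this is the first of two files discharging the binder **(C0) «`N_Δ(L⁺)\N_Δ(𝔸)` is compact»** of
★ `K2LiuIntertwiningConvergesOfParabolic` (O41.3), of K2Liu-p07's O41.4 volume term, and of K2Liu-p09's E5′c.

In the TRIANGULAR FRAME `E₁ · blk u · E₂` of ★ D9 `K2Lit/SiegelDoubledUnipotent`, `u ∈ N_Δ(𝔸)` iff its frame is `n(X) = (1 X; 0 1)`, `X = (blk u)₁₂`
(★ `mem_unipDelta_iff_conj`), and the frame is unitary for the frame form `J_F = (0 −T_𝔸; −T_𝔸 −T_𝔸)` (★ K2Liu-p02 `frame_blk_unitary`), so `X` is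
`T_𝔸`-SKEW-HERMITIAN: `T_𝔸 X + X^* T_𝔸 = 0` (★ B1 `unip_unitary_iff`).  Conversely every skew `X ∈ M_n(𝔸_L)` is the coordinate of a (unique) element
`n(X) ∈ N_Δ(𝔸)`; the point of this file is that `X ↦ n(X)` can be taken CONTINUOUS (into `H(𝔸) ≤ GL_{2n}(𝔸_L)` with its unit-group topology —
the matrix AND its inverse `n(−X)` depend polynomially on `X`, Mathlib `Units.continuous_iff`), ADDITIVE (`n(X) n(Y) = n(X + Y)`, ★ `unframe_unip_mul`),
RATIONAL on rational skew matrices (`n(X₀ ⊗ 1) ∈ H(L⁺)`, ★ `mem_range_toAdelic_iff`), and ONTO `N_Δ(𝔸)`: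

* `skew_of_mem_unipDelta` — the coordinate `(blk u)₁₂` of `u ∈ N_Δ(𝔸)` is `T_𝔸`-skew;
* `exists_unipChart` — **the chart**: `∃ φ : {X // T_𝔸 X + X^* T_𝔸 = 0} → N_Δ(𝔸)`, continuous, with frame `E₁ · blk (φ X) · E₂ = n(X)`, additive,
  surjective, and `φ X ∈ N_Δ(L⁺)` whenever `X = X₀ ⊗ 1` is rational.

Theorems only (the chart is an `∃`, R8: no definition in `Theorems/`); axioms ⊆ {propext, Classical.choice, Quot.sound}.

## References
* S. Gelbart, I. Piatetski-Shapiro, S. Rallis, LNM 1254 (1987), Part A §1 (`N = {n(X) : X ∈ Herm}`) [GelbartPiatetskishapiroRallis1987].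
* M. Harris, S. Kudla, W. Sweet, *Theta dichotomy for unitary groups*, JAMS 9 (1996), §1 (1.11)–(1.12) [HarrisKudlaSweet1996].

HONEST LABEL: HC_CM is proved only modulo the 7 printed citations (2 remaining named inputs: hLiu418 = stmt-HodgeConjecture-24832,
h413 = stmt-HodgeConjecture-24833) until rung 0 closes; this helper moves no counter.
-/

set_option autoImplicit false
set_option linter.dupNamespace false

noncomputable section

open scoped Matrix
open NumberField IsDedekindDomain

namespace Summit.HodgeConjecture.HodgeConjecture.Cruxes.HLiu418.K2LiuUnipotentChart

open Literature.NumberTheory.Automorphic Literature.NumberTheory.Automorphic.UnitaryGroup Literature.NumberTheory.GaloisRepresentations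
open Literature.NumberTheory.Automorphic.DoubledUnitary.RankOneReduction
open Literature.NumberTheory.GelbartRogawski1991 Literature.NumberTheory.GelbartRogawski1991.GRConstruction
open Literature.NumberTheory.K2Lit.SiegelDoubled
open Summit.HodgeConjecture.HodgeConjecture.Cruxes.HLiu418.K2LiuSiegelDoubledBlkUnitary
open Summit.HodgeConjecture.HodgeConjecture.Cruxes.HLiu418.K2LiuSiegelBruhatCellsUnitary
open Summit.HodgeConjecture.HodgeConjecture.Cruxes.HLiu418.K2LiuSiegelBruhatCellsDelta

variable (L : Type) [Field L] [NumberField L] [IsCMField L]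
variable {N M n : ℕ} (e : Fin N × Fin M ≃ Fin n)
  (dV : Fin N → L) (hdV : ∀ i, IsCMField.complexConj L (dV i) = dV i)
  (dW : Fin M → L) (hdW : ∀ i, IsCMField.complexConj L (dW i) = dW i)

/-! ## §1 The coordinate of an element of `N_Δ(𝔸)` is skew -/

/-- **The frame coordinate of `u ∈ N_Δ(𝔸)` is `T_𝔸`-skew-hermitian**: with `X = (blk u)₁₂`, `T_𝔸 X + σ(X)ᵀ T_𝔸 = 0` (the frame `n(X)` of `u` is
unitary for the frame form, ★ `frame_blk_unitary`, and ★ B1 `unip_unitary_iff`). [cite: GelbartPiatetskishapiroRallis1987, Part A §1]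
[cite: HarrisKudlaSweet1996, §1 (1.12)] -/
theorem skew_of_mem_unipDelta {u : HA L e dV hdV dW hdW} (hu : u ∈ unipDelta L e dV hdV dW hdW) :
    (gramR L e dV hdV dW hdW).map ((algebraMap L (AdeleRing (𝓞 L) L)).comp (algebraMap (Fp L) L)) * (blk L e dV hdV dW hdW u).toBlocks₁₂ +
      (((blk L e dV hdV dW hdW u).toBlocks₁₂).map (conjAdele (Fp L) L (IsCMField.complexConj L)))ᵀ *
        (gramR L e dV hdV dW hdW).map ((algebraMap L (AdeleRing (𝓞 L) L)).comp (algebraMap (Fp L) L)) = 0 := by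
  have hframe := (mem_unipDelta_iff_conj L e dV hdV dW hdW u).1 hu
  have hunit := frame_blk_unitary L e dV hdV dW hdW u
  rw [hframe] at hunit
  exact (unip_unitary_iff (conjAdele (Fp L) L (IsCMField.complexConj L)) _ _).1 hunit

/-- `blk u = E₂ · n(X) · E₁` for `u ∈ N_Δ(𝔸)`, `X = (blk u)₁₂` (unframing ★ `mem_unipDelta_iff_conj`). [cite: HarrisKudlaSweet1996, §1 (1.12)] -/
theorem blk_eq_unframe_of_mem_unipDelta {u : HA L e dV hdV dW hdW} (hu : u ∈ unipDelta L e dV hdV dW hdW) :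
    blk L e dV hdV dW hdW u =
      Matrix.fromBlocks (1 : Matrix (Fin n) (Fin n) (AdeleRing (𝓞 L) L)) 0 1 (1 : Matrix (Fin n) (Fin n) (AdeleRing (𝓞 L) L)) *
        Matrix.fromBlocks 1 (blk L e dV hdV dW hdW u).toBlocks₁₂ 0 1 *
        Matrix.fromBlocks (1 : Matrix (Fin n) (Fin n) (AdeleRing (𝓞 L) L)) 0 (-1) (1 : Matrix (Fin n) (Fin n) (AdeleRing (𝓞 L) L)) := by
  have hframe := (mem_unipDelta_iff_conj L e dV hdV dW hdW u).1 hu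
  rw [← hframe]
  calc blk L e dV hdV dW hdW u
      = (Matrix.fromBlocks (1 : Matrix (Fin n) (Fin n) (AdeleRing (𝓞 L) L)) 0 1 (1 : Matrix (Fin n) (Fin n) (AdeleRing (𝓞 L) L)) *
          Matrix.fromBlocks (1 : Matrix (Fin n) (Fin n) (AdeleRing (𝓞 L) L)) 0 (-1) (1 : Matrix (Fin n) (Fin n) (AdeleRing (𝓞 L) L))) *
          blk L e dV hdV dW hdW u *
          (Matrix.fromBlocks (1 : Matrix (Fin n) (Fin n) (AdeleRing (𝓞 L) L)) 0 1 (1 : Matrix (Fin n) (Fin n) (AdeleRing (𝓞 L) L)) *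
            Matrix.fromBlocks (1 : Matrix (Fin n) (Fin n) (AdeleRing (𝓞 L) L)) 0 (-1) (1 : Matrix (Fin n) (Fin n) (AdeleRing (𝓞 L) L))) := by
        rw [E₂_mul_E₁, Matrix.one_mul, Matrix.mul_one]
    _ = _ := by simp only [Matrix.mul_assoc]

/-! ## §2 The chart -/

/-- **THE UNIPOTENT CHART of `N_Δ(𝔸)`.**  There is a map `φ : M_n(𝔸_L) → GL_{2n}(𝔸_L)`, CONTINUOUS (unit-group topology: the matrix
`e₂·E₂·n(X)·E₁·e₂⁻¹` AND its inverse depend polynomially on `X`), ADDITIVE (`φ (X + Y) = φ X · φ Y`), RATIONAL on rational matrices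
(`φ (X₀ ⊗ 1)` is the base change of a rational unit), such that for every `T_𝔸`-SKEW-HERMITIAN `X` (`T_𝔸 X + σ(X)ᵀ T_𝔸 = 0`) the unit `φ X` lies
in `H(𝔸)`, indeed in `N_Δ(𝔸)` with frame `E₁ · blk · E₂ = n(X) = (1 X; 0 1)`, and every `u ∈ N_Δ(𝔸)` is `φ` of its coordinate `(blk u)₁₂`.
[cite: GelbartPiatetskishapiroRallis1987, Part A §1] [cite: HarrisKudlaSweet1996, §1 (1.12)] -/
theorem exists_unipChart :
    ∃ φ : Matrix (Fin n) (Fin n) (AdeleRing (𝓞 L) L) → GL (Fin (n + n)) (AdeleRing (𝓞 L) L),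
      Continuous φ ∧
      (∀ X Y, φ (X + Y) = φ X * φ Y) ∧
      (∀ X : Matrix (Fin n) (Fin n) (AdeleRing (𝓞 L) L),
        (gramR L e dV hdV dW hdW).map ((algebraMap L (AdeleRing (𝓞 L) L)).comp (algebraMap (Fp L) L)) * X +
            (X.map (conjAdele (Fp L) L (IsCMField.complexConj L)))ᵀ *
              (gramR L e dV hdV dW hdW).map ((algebraMap L (AdeleRing (𝓞 L) L)).comp (algebraMap (Fp L) L)) = 0 →
          ∃ hX : φ X ∈ HA L e dV hdV dW hdW, (⟨φ X, hX⟩ : HA L e dV hdV dW hdW) ∈ unipDelta L e dV hdV dW hdW ∧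
            Matrix.fromBlocks (1 : Matrix (Fin n) (Fin n) (AdeleRing (𝓞 L) L)) 0 (-1) (1 : Matrix (Fin n) (Fin n) (AdeleRing (𝓞 L) L)) *
                blk L e dV hdV dW hdW ⟨φ X, hX⟩ *
                Matrix.fromBlocks (1 : Matrix (Fin n) (Fin n) (AdeleRing (𝓞 L) L)) 0 1 (1 : Matrix (Fin n) (Fin n) (AdeleRing (𝓞 L) L)) =
              Matrix.fromBlocks 1 X 0 1) ∧
      (∀ u : HA L e dV hdV dW hdW, u ∈ unipDelta L e dV hdV dW hdW →
        φ (blk L e dV hdV dW hdW u).toBlocks₁₂ = (u : GL (Fin (n + n)) (AdeleRing (𝓞 L) L))) ∧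
      (∀ X₀ : Matrix (Fin n) (Fin n) L,
        φ (X₀.map (algebraMap L (AdeleRing (𝓞 L) L))) ∈ (Matrix.GeneralLinearGroup.map (algebraMap L (AdeleRing (𝓞 L) L))).range) := by
  set σ := conjAdele (Fp L) L (IsCMField.complexConj L) with hσ
  set T : Matrix (Fin n) (Fin n) (AdeleRing (𝓞 L) L) :=
    (gramR L e dV hdV dW hdW).map ((algebraMap L (AdeleRing (𝓞 L) L)).comp (algebraMap (Fp L) L)) with hT
  -- the unframed matrices `B(X) = E₂ n(X) E₁`
  let E₂M : Matrix (Fin n ⊕ Fin n) (Fin n ⊕ Fin n) (AdeleRing (𝓞 L) L) :=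
    Matrix.fromBlocks (1 : Matrix (Fin n) (Fin n) (AdeleRing (𝓞 L) L)) 0 1 (1 : Matrix (Fin n) (Fin n) (AdeleRing (𝓞 L) L))
  let E₁M : Matrix (Fin n ⊕ Fin n) (Fin n ⊕ Fin n) (AdeleRing (𝓞 L) L) :=
    Matrix.fromBlocks (1 : Matrix (Fin n) (Fin n) (AdeleRing (𝓞 L) L)) 0 (-1) (1 : Matrix (Fin n) (Fin n) (AdeleRing (𝓞 L) L))
  let B : Matrix (Fin n) (Fin n) (AdeleRing (𝓞 L) L) → Matrix (Fin n ⊕ Fin n) (Fin n ⊕ Fin n) (AdeleRing (𝓞 L) L) :=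
    fun X => E₂M * Matrix.fromBlocks 1 X 0 1 * E₁M
  have hBmul : ∀ X Y, B X * B Y = B (X + Y) := fun X Y => unframe_unip_mul X Y
  have hB0 : B 0 = 1 := by
    show E₂M * Matrix.fromBlocks 1 0 0 1 * E₁M = 1
    rw [Matrix.fromBlocks_one, Matrix.mul_one]
    exact E₂_mul_E₁
  have hBinv : ∀ X, B X * B (-X) = 1 := fun X => by rw [hBmul, add_neg_cancel, hB0]
  have hBinv' : ∀ X, B (-X) * B X = 1 := fun X => by rw [hBmul, neg_add_cancel, hB0]
  -- the reindexed units
  let g : Matrix (Fin n) (Fin n) (AdeleRing (𝓞 L) L) → GL (Fin (n + n)) (AdeleRing (𝓞 L) L) := fun X =>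
    ⟨Matrix.reindex (e₂ (n := n)) (e₂ (n := n)) (B X), Matrix.reindex (e₂ (n := n)) (e₂ (n := n)) (B (-X)),
      by rw [Matrix.reindex_apply, Matrix.reindex_apply, Matrix.submatrix_mul_equiv, hBinv, Matrix.submatrix_one_equiv],
      by rw [Matrix.reindex_apply, Matrix.reindex_apply, Matrix.submatrix_mul_equiv, hBinv', Matrix.submatrix_one_equiv]⟩
  have hgval : ∀ X, ((g X : GL (Fin (n + n)) (AdeleRing (𝓞 L) L)) : Matrix (Fin (n + n)) (Fin (n + n)) (AdeleRing (𝓞 L) L)) =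
      Matrix.reindex (e₂ (n := n)) (e₂ (n := n)) (B X) := fun X => rfl
  -- unitarity of `B(X)` for skew `X`, membership in `H(𝔸)` and in `N_Δ(𝔸)`
  have hunit : ∀ X : Matrix (Fin n) (Fin n) (AdeleRing (𝓞 L) L), T * X + (X.map σ)ᵀ * T = 0 →
      ((B X).map σ)ᵀ * Matrix.fromBlocks T 0 0 (-T) * B X = Matrix.fromBlocks T 0 0 (-T) := fun X hX =>
    unframe_unitary_of_frame_unitary σ T ((unip_unitary_iff σ T X).2 hX)
  have hmem : ∀ X : Matrix (Fin n) (Fin n) (AdeleRing (𝓞 L) L), T * X + (X.map σ)ᵀ * T = 0 → g X ∈ HA L e dV hdV dW hdW := by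
    intro X hX
    show g X ∈ unitaryGroupOfForm (conjAdele (Fp L) L (IsCMField.complexConj L)) (adelicForm L (n + n) (hermD L e dV hdV dW hdW))
    rw [mem_unitaryGroupOfForm_iff, adelicForm_hermD_eq_reindex L e dV hdV dW hdW, hgval]
    rw [← reindex_cstar, ← reindex_mul_mul, hunit X hX]
  have hblk : ∀ (X : Matrix (Fin n) (Fin n) (AdeleRing (𝓞 L) L)) (hX : T * X + (X.map σ)ᵀ * T = 0),
      blk L e dV hdV dW hdW ⟨g X, hmem X hX⟩ = B X := fun X hX => reindex_symm_reindex (B X)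
  have hframe : ∀ (X : Matrix (Fin n) (Fin n) (AdeleRing (𝓞 L) L)) (hX : T * X + (X.map σ)ᵀ * T = 0),
      E₁M * blk L e dV hdV dW hdW ⟨g X, hmem X hX⟩ * E₂M = Matrix.fromBlocks 1 X 0 1 := fun X hX => by
    rw [hblk X hX]; exact frame_unframe _
  refine ⟨g, ?_, fun X Y => ?_, fun X hX => ⟨hmem X hX, (mem_unipDelta_iff L e dV hdV dW hdW _).2 ⟨X, hframe X hX⟩, hframe X hX⟩,
    fun u hu => ?_, fun X₀ => ?_⟩
  · -- continuity: matrix and inverse are polynomial in `X`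
    have hBc : Continuous fun X : Matrix (Fin n) (Fin n) (AdeleRing (𝓞 L) L) => B X :=
      (continuous_const.matrix_mul (Continuous.matrix_fromBlocks continuous_const continuous_id continuous_const continuous_const)).matrix_mul
        continuous_const
    have hBc' : Continuous fun X : Matrix (Fin n) (Fin n) (AdeleRing (𝓞 L) L) => B (-X) := hBc.comp continuous_neg
    exact Units.continuous_iff.2 ⟨hBc.matrix_submatrix (e₂ (n := n)).symm (e₂ (n := n)).symm,
      hBc'.matrix_submatrix (e₂ (n := n)).symm (e₂ (n := n)).symm⟩
  · -- additivity
    refine Units.ext ?_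
    rw [Units.val_mul, hgval, hgval, hgval, ← hBmul, Matrix.reindex_apply, Matrix.reindex_apply, Matrix.reindex_apply,
      Matrix.submatrix_mul_equiv]
  · -- every `u ∈ N_Δ(𝔸)` is `φ` of its coordinate
    refine Units.ext ?_
    rw [hgval]
    show Matrix.reindex (e₂ (n := n)) (e₂ (n := n))
        (Matrix.fromBlocks (1 : Matrix (Fin n) (Fin n) (AdeleRing (𝓞 L) L)) 0 1 (1 : Matrix (Fin n) (Fin n) (AdeleRing (𝓞 L) L)) *
          Matrix.fromBlocks 1 (blk L e dV hdV dW hdW u).toBlocks₁₂ 0 1 *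
          Matrix.fromBlocks (1 : Matrix (Fin n) (Fin n) (AdeleRing (𝓞 L) L)) 0 (-1) (1 : Matrix (Fin n) (Fin n) (AdeleRing (𝓞 L) L))) = _
    rw [← blk_eq_unframe_of_mem_unipDelta L e dV hdV dW hdW hu]
    exact reindex_reindex_symm _
  · -- rationality
    let B₀ : Matrix (Fin n ⊕ Fin n) (Fin n ⊕ Fin n) L :=
      Matrix.fromBlocks (1 : Matrix (Fin n) (Fin n) L) 0 1 (1 : Matrix (Fin n) (Fin n) L) * Matrix.fromBlocks 1 X₀ 0 1 *
        Matrix.fromBlocks (1 : Matrix (Fin n) (Fin n) L) 0 (-1) (1 : Matrix (Fin n) (Fin n) L)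
    let B₀' : Matrix (Fin n ⊕ Fin n) (Fin n ⊕ Fin n) L :=
      Matrix.fromBlocks (1 : Matrix (Fin n) (Fin n) L) 0 1 (1 : Matrix (Fin n) (Fin n) L) * Matrix.fromBlocks 1 (-X₀) 0 1 *
        Matrix.fromBlocks (1 : Matrix (Fin n) (Fin n) L) 0 (-1) (1 : Matrix (Fin n) (Fin n) L)
    have hB₀mul : B₀ * B₀' = 1 := by
      show Matrix.fromBlocks (1 : Matrix (Fin n) (Fin n) L) 0 1 (1 : Matrix (Fin n) (Fin n) L) * Matrix.fromBlocks 1 X₀ 0 1 *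
          Matrix.fromBlocks (1 : Matrix (Fin n) (Fin n) L) 0 (-1) (1 : Matrix (Fin n) (Fin n) L) *
          (Matrix.fromBlocks (1 : Matrix (Fin n) (Fin n) L) 0 1 (1 : Matrix (Fin n) (Fin n) L) * Matrix.fromBlocks 1 (-X₀) 0 1 *
            Matrix.fromBlocks (1 : Matrix (Fin n) (Fin n) L) 0 (-1) (1 : Matrix (Fin n) (Fin n) L)) = 1
      rw [unframe_unip_mul, add_neg_cancel, Matrix.fromBlocks_one, Matrix.mul_one, E₂_mul_E₁]
    have hB₀mul' : B₀' * B₀ = 1 := by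
      show Matrix.fromBlocks (1 : Matrix (Fin n) (Fin n) L) 0 1 (1 : Matrix (Fin n) (Fin n) L) * Matrix.fromBlocks 1 (-X₀) 0 1 *
          Matrix.fromBlocks (1 : Matrix (Fin n) (Fin n) L) 0 (-1) (1 : Matrix (Fin n) (Fin n) L) *
          (Matrix.fromBlocks (1 : Matrix (Fin n) (Fin n) L) 0 1 (1 : Matrix (Fin n) (Fin n) L) * Matrix.fromBlocks 1 X₀ 0 1 *
            Matrix.fromBlocks (1 : Matrix (Fin n) (Fin n) L) 0 (-1) (1 : Matrix (Fin n) (Fin n) L)) = 1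
      rw [unframe_unip_mul, neg_add_cancel, Matrix.fromBlocks_one, Matrix.mul_one, E₂_mul_E₁]
    let g₀ : GL (Fin (n + n)) L :=
      ⟨Matrix.reindex (e₂ (n := n)) (e₂ (n := n)) B₀, Matrix.reindex (e₂ (n := n)) (e₂ (n := n)) B₀',
        by rw [Matrix.reindex_apply, Matrix.reindex_apply, Matrix.submatrix_mul_equiv, hB₀mul, Matrix.submatrix_one_equiv],
        by rw [Matrix.reindex_apply, Matrix.reindex_apply, Matrix.submatrix_mul_equiv, hB₀mul', Matrix.submatrix_one_equiv]⟩
    have hmap : B₀.map (algebraMap L (AdeleRing (𝓞 L) L)) = B (X₀.map (algebraMap L (AdeleRing (𝓞 L) L))) := by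
      show (Matrix.fromBlocks (1 : Matrix (Fin n) (Fin n) L) 0 1 (1 : Matrix (Fin n) (Fin n) L) * Matrix.fromBlocks 1 X₀ 0 1 *
          Matrix.fromBlocks (1 : Matrix (Fin n) (Fin n) L) 0 (-1) (1 : Matrix (Fin n) (Fin n) L)).map (algebraMap L (AdeleRing (𝓞 L) L)) =
        E₂M * Matrix.fromBlocks 1 (X₀.map (algebraMap L (AdeleRing (𝓞 L) L))) 0 1 * E₁M
      rw [Matrix.map_mul, Matrix.map_mul]
      simp only [Matrix.fromBlocks_map, Matrix.map_one (algebraMap L (AdeleRing (𝓞 L) L)) (map_zero _) (map_one _),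
        Matrix.map_zero (algebraMap L (AdeleRing (𝓞 L) L)) (map_zero _),
        Matrix.map_neg (algebraMap L (AdeleRing (𝓞 L) L)) (map_neg _)]
      rfl
    refine ⟨g₀, Units.ext ?_⟩
    rw [hgval]
    show (Matrix.reindex (e₂ (n := n)) (e₂ (n := n)) B₀).map (algebraMap L (AdeleRing (𝓞 L) L)) = _
    rw [Matrix.reindex_apply, Matrix.reindex_apply, ← Matrix.submatrix_map, hmap]

end Summit.HodgeConjecture.HodgeConjecture.Cruxes.HLiu418.K2LiuUnipotentChart

end
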